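/-
b2b-lace packet, LEAN TYPING SEAT 2 gen 18 (unit `b2b-lace-lean2-g18`).  (S2b)-IMPR, the two NEAR CELLS of `f₃`: on the shell `‖x‖₁ = 2` of
`𝒳` the cells `(0,0,𝒳)` and `(1,0,𝒳)` of [FvdH17] (2.23) are NOT read through the table majorant `boundHD75` (the notebook's `BoundFThree`), but
through the explicit forms `ℋ^{0,0}_p(x) = ‖x‖₂² τ_p(x)` and `ℋ^{1,0}_p(x) ≤ ‖x‖₂² τ_p(x) + 2dp ℋ^{1,1}_p(x)` and the a-priori two-point bound
`τ_p(x) ≤ 2p² + (2dp)⁴ (D^{⋆4} ⋆ τ_p)(x) ≤ 2 (Γ₁/(2d-1))² + (2dΓ₁/(2d-1))⁴ ((2d-2)/(2d-1) Γ₂) I_{1,4}(0)` — the notebook's small-`x` reading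
(Percolation.nb `boundF3[2,o]`, `boundF3[3,o]`: `Bound[G,·,2,o]` at `‖x‖₁ ≤ 2`, `BoundFThreeBound[n,l,{Q nodes}]` on `Q = {‖x‖₁ ≥ 3}`).
Additive: no existing module is modified; d-generic; no numeral; no named fact; no dimension-specific sentence.
-/
import Literature.Probability.FitznerVanDerHofstad2017.F3BoundsCellSplit
import Literature.Probability.FitznerVanDerHofstad2017.BubbleTailLiftResidue
import Literature.Probability.FitznerVanDerHofstad2017.NonRepulsiveDiagramBounds
import Literature.Probability.FitznerVanDerHofstad2017.SrwIntegralSupZero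
import Literature.Probability.FitznerVanDerHofstad2017.TrailCountTables
import Literature.Probability.FitznerVanDerHofstad2017.NbwRemainderFramePrinted
import Literature.Probability.RandomPlanarGeometry.BDGS2012HaraSladeCounts
import HarnessLib

/-!
# Literature.Probability.FitznerVanDerHofstad2017.NobleWeightedDiagramBoundSmallX — the near cells `(0,0,𝒳)`, `(1,0,𝒳)` of `f₃` on the shell `‖x‖₁ = 2`

CITATION HEADER (PLACEMENT v2). Part of a certified REPRODUCTION of R. Fitzner, R. van der Hofstad, *Mean-field behavior for nearest-neighbor
percolation in `d > 10`*, Electron. J. Probab. 22 (2017) no. 43 [FvdH17] and *Generalized approach to the non-backtracking lace expansion*,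
Probab. Theory Related Fields 169 (2017) 1041–1119 [NoBLE17].  What is typed here is the READING of the two near cells of the bootstrap function
`f₃` ([FvdH17] (2.21)–(2.23)) that the authors' notebook `Percolation.nb` implements (`boundF3[2,o]`, `boundF3[3,o]`): on the two `W_d`-orbits of
the shell `‖x‖₁ = 2` of `𝒳 = {‖x‖₂ > 1}` the weighted diagrams `ℋ^{0,0}_p(x) = ‖x‖₂² τ_p(x)` and `ℋ^{1,0}_p(x)` are bounded DIRECTLY through the
two-point function (the notebook's `Bound[G,{2},2,o]`, `Bound[G,{0,1},2,o]`), and only on `Q = {‖x‖₁ ≥ 3}` through the five-piece table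
majorant `BoundFThree` = `F3Bounds.boundHD75` of [NoBLE17] §3.3.5 (3.87).  (The entrywise table majorant at the shell points `2e₁`, `e₁ + e₂`
exceeds the cells' constants `c_{0,0,𝒳} Γ₃`, `c_{1,0,𝒳} Γ₃` of [FvdH17] Figure 3, so the plain reading "table majorant on all of `𝒳`" of the
landed doorsteps is not the computation the paper reports; this module supplies the reading that is.)
CONTENT (all d-generic, sorry-free, no numeral):
§1 `nobleH_zero_zero_eq` — `ℋ^{0,0}_p(x) = ‖x‖₂² τ_p(x)` (definition (2.21) with `τ_p^{⋆0} ⋆ D^{⋆0} = δ₀`); `nobleH_one_zero_le` —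
   `ℋ^{1,0}_p(x) ≤ ‖x‖₂² τ_p(x) + 2dp · ℋ^{1,1}_p(x)` below `p_c` (split the sum `Σ_y ‖y‖₂² τ_p(y) τ_p(x−y)` at `y = x`; for `y ≠ x` the BK
   first-step bound [FvdH17] (4.3) `τ_p(u) ≤ 2dp (D ⋆ τ_p)(u)`, `u ≠ 0`, and `τ_p ⋆ D = D ⋆ τ_p`).
§2 `tau_le_of_sum_abs_eq_two` — for `‖x‖₁ = 2`, `d ≥ 3`, `p < p_c`, `(2d−1)p ≤ Γ₁`, `f₂(p) ≤ Γ₂`: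
   `τ_p(x) ≤ 2 (Γ₁/(2d−1))² + (2dΓ₁/(2d−1))⁴ · ((2d−2)/(2d−1) Γ₂) · I_{1,4}(0)` ([FvdH17] (4.18) with `n = 0`, `M = 4`: `a_0(x) = a_1(x) = a_3(x) = 0`,
   `a_2(x) ≤ #{2-step walks 0 → x} ≤ 2`, and the SRW tail [NoBLE17] §5.3.2 `(2dp)⁴ (D^{⋆4} ⋆ τ_p)(x) ≤ (2dΓ₁/(2d−1))⁴ Γ̄₂ K_{1,4}(x)`,
   `K_{1,4}(x) ≤ I_{1,4}(0)` [NoBLE17] (5.14)); `tau_le_smallX_of_srwI_le` is the same with a displayed value `I_{1,4}(0) ≤ V`.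
§3 `euclidNorm_sq_le_four_of_sum_abs_eq_two` (`‖x‖₂² ≤ 4` on the shell); `nobleH_le_boundHD75_srwTrue` — the pointwise majorant
   `ℋ^{n,l}_p(x) ≤ boundHD75 (srwTrue d α̲ ᾱ) n l x r` (`n ≤ 1`) from an admissible witness, every table-side condition discharged at the true tables
   (composition of `abs_nobleH_le_boundHD75_of_witness`, `NobleF3Witness.step1_of_tables` and `NobleF3TrueTables` §2).
§4 `nobleWeightedDiagramBoundAt_of_witness_srwTrue_smallX`, `…_of_simplifiedFormF3_srwTrue_smallX` — the six cells with the near/far READING: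
   cells `(0,0)`, `(1,0)` as `4 τ_p(x) ≤ b₀` and `4 τ_p(x) + 2dp · b₂ ≤ b₁` on the shell and the table majorant on `Q`; cells `(1,1)`, `(1,2)`, `(1,3)`
   on `𝒳` and `(1,6)` at `0` unchanged.
§5 `nobleImprovementInputsAt_of_simplifiedFormF3_srwTrue_smallX` — packaged over the window `p ∈ (p_I, p_c)`, `f_i(p) ≤ Γ_i`, with the shell
   cells discharged from `f₁ ≤ Γ₁`, `f₂ ≤ Γ₂` and two NUMERIC inequalities in the bootstrap constants only (`I_{1,4}(0) ≤ V`):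
   `4 S ≤ b₀` and `4 S + (2d/(2d−1)) Γ₁ · b₂ ≤ b₁` with `S = 2 (Γ₁/(2d−1))² + (2dΓ₁/(2d−1))⁴ ((2d−2)/(2d−1) Γ₂) V`.
What remains displayed after this module: the table-majorant cells on `Q` for `(0,0)`, `(1,0)`, on `𝒳` for `(1,1)`, `(1,2)`, `(1,3)`, at `0` for
`(1,6)`, the SRW value `I_{1,4}(0) ≤ V` and the two numeric shell inequalities.  No dimension-specific sentence is made here.
[cite: FitznerVanDerHofstad2017, (2.21)–(2.23) and §2.5 (EJP pp. 8–9, 11–12); §4.2 (4.1)–(4.3), (4.18) (EJP pp. 31–33);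
 notebook Percolation.nb `boundF3[2,o]`, `boundF3[3,o]`, `Bound[G,s,2,o]`]
[cite: FitznerVanDerHofstad2016NoBLE, §3.3.5 (3.87) p. 1079 and §5.1 p. 1093 (the set Q); §5.3.1 (5.37), §5.3.2 (first display) p. 1097; (5.14) p. 1092]
-/

noncomputable section

open MeasureTheory Real
open Literature.Barriers.CriticalPhenomena
open Literature.Barriers.CriticalPhenomena.SpreadOutIsing (delta0 latticeConv convPow latticeConv_comm latticeConv_delta0 convPow_one_eq)
open Literature.Probability.LatticeModels
open Literature.Probability.Percolation
open Literature.Probability.RandomPlanarGeometry.SAW.Zd (srwCount_two_le_two)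

namespace Literature.Probability.FitznerVanDerHofstad2017

variable {d : ℕ}

/-! ## 1. The near cells are explicit in the two-point function -/

/-- **`ℋ^{0,0}_p(x) = ‖x‖₂² τ_p(x)`** (`τ_p^{⋆0} ⋆ D^{⋆0} = δ₀ ⋆ δ₀ = δ₀` in definition (2.21)). [cite: FitznerVanDerHofstad2017, (2.21)]
[cite: FitznerVanDerHofstad2016NoBLE, §3.3.1 (3.9)] -/
theorem nobleH_zero_zero_eq (p : unitInterval) (x : Site d) : nobleH d 0 0 p x = euclidNorm x ^ 2 * tau d p 0 x := by
  classical
  unfold nobleH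
  have hker : ∀ z : Site d, latticeConv (convPow (tau d p 0) 0) (convPow (srwStep d) 0) z = delta0 z := fun z =>
    latticeConv_delta0 delta0 z
  simp_rw [hker]
  rw [tsum_eq_single x]
  · simp [delta0]
  · intro y hy
    have hne : x - y ≠ 0 := sub_ne_zero.2 (Ne.symm hy)
    simp [delta0, hne]

/-- **`ℋ^{1,0}_p(x) ≤ ‖x‖₂² τ_p(x) + 2dp · ℋ^{1,1}_p(x)`** below `p_c` (`d ≥ 2`): in `ℋ^{1,0}_p(x) = Σ_y ‖y‖₂² τ_p(y) τ_p(x − y)` the term `y = x`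
is `‖x‖₂² τ_p(x)` (`τ_p(0) = 1`), and for `y ≠ x` the first-step BK bound `τ_p(u) ≤ 2dp (D ⋆ τ_p)(u)` (`u = x − y ≠ 0`, [FvdH17] (4.3) with
`τ_{1,p}(u) = τ_p(u)`) turns the rest into `2dp Σ_y ‖y‖₂² τ_p(y) (τ_p ⋆ D)(x − y) = 2dp ℋ^{1,1}_p(x)`.
[cite: FitznerVanDerHofstad2017, (2.21); §4.2 (4.1), (4.3) (EJP pp. 31–32); notebook Percolation.nb `boundF3[3,o]`] -/
theorem nobleH_one_zero_le (hd : 2 ≤ d) (p : unitInterval) (hp : (p : ℝ) < criticalProb (zdGraph d) (0 : Site d)) (x : Site d) :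
    nobleH d 1 0 p x ≤ euclidNorm x ^ 2 * tau d p 0 x + 2 * d * (p : ℝ) * nobleH d 1 1 p x := by
  classical
  have hd1 : 1 ≤ d := by omega
  have hs : Summable fun x => tau d p 0 x := summable_tau_of_lt_criticalProb hd p hp
  have hW : Summable (tauW d p) := summable_tauW hd p hp
  have hτ0 : ∀ z : Site d, 0 ≤ tau d p 0 z := fun z => tau_nonneg p 0 z
  -- the two kernels `τ^{⋆1} ⋆ D^{⋆0} = τ` and `τ^{⋆1} ⋆ D^{⋆1} = D ⋆ τ`
  have hk0 : ∀ z : Site d, latticeConv (convPow (tau d p 0) 1) (convPow (srwStep d) 0) z = tau d p 0 z := fun z => by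
    rw [convPow_one_eq]; exact latticeConv_delta0 _ z
  have hk1 : ∀ z : Site d, latticeConv (convPow (tau d p 0) 1) (convPow (srwStep d) 1) z =
      latticeConv (srwStep d) (tau d p 0) z := fun z => by
    rw [convPow_one_eq, convPow_one_eq, latticeConv_comm]
  have h10 : nobleH d 1 0 p x = ∑' y, tauW d p y * tau d p 0 (x - y) := by
    unfold nobleH; exact tsum_congr fun y => by rw [hk0]; rfl
  have h11 : nobleH d 1 1 p x = ∑' y, tauW d p y * latticeConv (srwStep d) (tau d p 0) (x - y) := by
    unfold nobleH; exact tsum_congr fun y => by rw [hk1]; rfl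
  -- summability of the two inner families
  have hF : Summable fun y => tauW d p y * tau d p 0 (x - y) := summable_latticeConv_inner hW hs (tauW_nonneg p) hτ0 x
  have hDτ : Summable (latticeConv (srwStep d) (tau d p 0)) := summable_latticeConv summable_srwStep hs srwStep_nonneg hτ0
  have hDτ0 : ∀ z, 0 ≤ latticeConv (srwStep d) (tau d p 0) z := latticeConv_nonneg srwStep_nonneg hτ0
  have hG : Summable fun y => tauW d p y * latticeConv (srwStep d) (tau d p 0) (x - y) :=
    summable_latticeConv_inner hW hDτ (tauW_nonneg p) hDτ0 x
  -- split off the term `y = x`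
  have hsplit : ∑' y, tauW d p y * tau d p 0 (x - y) =
      tauW d p x + ∑' y, ite (y = x) 0 (tauW d p y * tau d p 0 (x - y)) := by
    rw [hF.tsum_eq_add_tsum_ite x]; simp only [sub_self, tau_self, mul_one]
  have hWx : tauW d p x = euclidNorm x ^ 2 * tau d p 0 x := rfl
  have h2dp : 0 ≤ 2 * d * (p : ℝ) := by have := p.2.1; positivity
  have htg : tauGe d p 0 = tau d p 0 := funext fun z => tauGe_zero_eq_tau p z
  -- termwise comparison of the remainder with `2dp · ‖y‖₂² τ_p(y) (D ⋆ τ_p)(x − y)`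
  have hpt : ∀ y, ite (y = x) 0 (tauW d p y * tau d p 0 (x - y)) ≤
      2 * d * (p : ℝ) * (tauW d p y * latticeConv (srwStep d) (tau d p 0) (x - y)) := fun y => by
    split_ifs with hy
    · exact mul_nonneg h2dp (mul_nonneg (tauW_nonneg p y) (hDτ0 _))
    · have hne : x - y ≠ 0 := sub_ne_zero.2 (Ne.symm hy)
      have hstep : tau d p 0 (x - y) ≤ 2 * d * (p : ℝ) * latticeConv (srwStep d) (tau d p 0) (x - y) := by
        have h := tauGe_succ_le_srwStep_conv hd1 p 0 (x - y)
        rwa [tauGe_one_eq_tau p hne, htg] at h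
      calc tauW d p y * tau d p 0 (x - y) ≤ tauW d p y * (2 * d * (p : ℝ) * latticeConv (srwStep d) (tau d p 0) (x - y)) :=
            mul_le_mul_of_nonneg_left hstep (tauW_nonneg p y)
        _ = _ := by ring
  have hI : Summable fun y => ite (y = x) 0 (tauW d p y * tau d p 0 (x - y)) :=
    Summable.of_nonneg_of_le
      (fun y => by split_ifs; exacts [le_rfl, mul_nonneg (tauW_nonneg p y) (hτ0 _)])
      (fun y => by split_ifs; exacts [mul_nonneg (tauW_nonneg p y) (hτ0 _), le_rfl]) hF
  rw [h10, hsplit, hWx, h11, ← tsum_mul_left]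
  exact add_le_add le_rfl (hI.tsum_le_tsum hpt (hG.mul_left _))

/-! ## 2. The two-point function on the shell `‖x‖₁ = 2` -/

/-- `‖x‖₁` (the `ℕ`-valued `l1Norm` of the trail-count tables) as the integer `Σ_j |x_j|` (the shell / `Q` split is by `‖x‖₁`).
[cite: FitznerVanDerHofstad2016NoBLE, §5.1 p. 1093 (the points with small ‖x‖₁ and the set Q)] -/
theorem natCast_l1Norm (x : Site d) : ((l1Norm x : ℕ) : ℤ) = ∑ j, |x j| := by
  simp [l1Norm, Nat.cast_sum]

/-- **A-priori bound on `τ_p(x)` for `‖x‖₁ = 2`** (`d ≥ 3`, `p < p_c`, `(2d−1)p ≤ Γ₁`, `f₂(p) ≤ Γ₂`):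
`τ_p(x) ≤ 2 (Γ₁/(2d−1))² + (2dΓ₁/(2d−1))⁴ · ((2d−2)/(2d−1) Γ₂) · I_{1,4}(0)`.  [FvdH17] (4.18) at `n = 0`, `M = 4`: the trail counts `a_0(x) = a_1(x) = 0`
(`‖x‖₁ = 2 > r`), `a_3(x) = 0` (parity), `a_2(x) ≤ #{2-step walks 0 → x} ≤ 2`, so the explicit part is `≤ 2p² ≤ 2(Γ₁/(2d−1))²`; the tail
`(2dp)⁴ (D^{⋆4} ⋆ τ_p)(x) ≤ (2dΓ₁/(2d−1))⁴ Γ̄₂ K_{1,4}(x)` ([NoBLE17] §5.3.2) with `Γ̄₂ ≤ (2d−2)/(2d−1) Γ₂` and `K_{1,4}(x) ≤ I_{1,4}(0)` ((5.14)).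
[cite: FitznerVanDerHofstad2017, §4.2 (4.18) and the sentence after it (EJP p. 33); notebook Percolation.nb `Bound[G,{2},2,o]`, `Bound[G,{0,1},2,o]`]
[cite: FitznerVanDerHofstad2016NoBLE, §5.3.1 (5.37), §5.3.2 (first display) p. 1097; (5.14) p. 1092; (2.6)] -/
theorem tau_le_of_sum_abs_eq_two (hd : 3 ≤ d) (p : unitInterval) (hp : p < criticalProbI d) {Γ₁ Γ₂ : ℝ}
    (hΓ1 : (2 * d - 1) * (p : ℝ) ≤ Γ₁) (hΓ2 : nobleF2 d p ≤ Γ₂) {x : Site d} (hx : ∑ j, |x j| = 2) :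
    tau d p 0 x ≤ 2 * (Γ₁ / (2 * d - 1)) ^ 2 + (2 * d / (2 * d - 1) * Γ₁) ^ 4 * ((2 * d - 2) / (2 * d - 1) * Γ₂) * srwI d 1 4 0 := by
  classical
  have hl1 : l1Norm x = 2 := by have := natCast_l1Norm x; omega
  have hx0 : x ≠ 0 := by rintro rfl; simp at hx
  have hd2 : 2 ≤ d := by omega
  -- (4.18) with `n = 0`, `M = 4` and the SRW tail
  have hext := tauGe_le_trailExtraction_srw p 0 4 x
  rw [tauGe_zero_eq_tau] at hext
  -- the explicit terms
  have ha0 : (trailWordsTo d 0 x).card = 0 := card_trailWordsTo_eq_zero_of_lt 0 x (by omega)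
  have ha1 : (trailWordsTo d 1 x).card = 0 := card_trailWordsTo_eq_zero_of_lt 1 x (by omega)
  have ha3 : (trailWordsTo d 3 x).card = 0 := card_trailWordsTo_eq_zero_of_odd 3 x (by omega)
  have ha2 : ((trailWordsTo d 2 x).card : ℝ) ≤ 2 := by
    exact_mod_cast (card_trailWordsTo_le_count d 2 x).trans (srwCount_two_le_two hx0)
  have hp0 : 0 ≤ (p : ℝ) := p.2.1
  have hsum : (∑ r ∈ Finset.Ico 0 4, (p : ℝ) ^ r * ((trailWordsTo d r x).card : ℝ)) ≤ 2 * (p : ℝ) ^ 2 := by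
    rw [← Finset.range_eq_Ico]
    simp only [Finset.sum_range_succ, Finset.sum_range_zero, ha0, ha1, ha3, Nat.cast_zero, mul_zero, add_zero, zero_add]
    nlinarith [mul_le_mul_of_nonneg_left ha2 (sq_nonneg (p : ℝ))]
  -- the tail
  have hΓ2' : 0 ≤ (2 * d - 2) / (2 * d - 1) * Γ₂ := (nobleSup2_nonneg' p).trans (nobleSup2_le_of_nobleF2_le hd2 p hΓ2)
  have htail : (2 * d * (p : ℝ)) ^ 4 * latticeConv (convPow (srwStep d) 4) (tau d p 0) x ≤
      (2 * d / (2 * d - 1) * Γ₁) ^ 4 * ((2 * d - 2) / (2 * d - 1) * Γ₂) * srwI d 1 4 0 := by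
    have h := srwConvTau_le_printed (n := 1) (by omega) hd2 p hp hΓ1 hΓ2 4 x
    rw [convPow_one_eq, pow_one] at h
    refine h.trans (mul_le_mul_of_nonneg_left ?_ (mul_nonneg (Even.pow_nonneg (by decide) _) hΓ2'))
    simpa using srwK_le_srwI_zero_of_even (n := 1) (by omega) 2 x
  -- `p ≤ Γ₁/(2d−1)`
  have hdR : (3 : ℝ) ≤ d := by exact_mod_cast hd
  have h2d1 : (0 : ℝ) < 2 * d - 1 := by linarith
  have hpΓ : (p : ℝ) ≤ Γ₁ / (2 * d - 1) := by rw [le_div_iff₀ h2d1]; linarith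
  have hpsq : (p : ℝ) ^ 2 ≤ (Γ₁ / (2 * d - 1)) ^ 2 := pow_le_pow_left₀ hp0 hpΓ 2
  linarith

/-- **The small-`x` two-point majorant in the bootstrap constants**: on the shell `‖x‖₁ = 2`, when `I_{1,4}(0) ≤ V` (`d ≥ 3`, `p < p_c`,
`(2d−1)p ≤ Γ₁`, `f₂(p) ≤ Γ₂`), `τ_p(x) ≤ 2 (Γ₁/(2d−1))² + (2dΓ₁/(2d−1))⁴ · ((2d−2)/(2d−1) Γ₂) · V` (the notebook's `Bound[G,s,2,o]` shape).
[cite: FitznerVanDerHofstad2017, §4.2 (4.18) (EJP p. 33); notebook Percolation.nb `Bound[G,s,2,o]`]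
[cite: FitznerVanDerHofstad2016NoBLE, §5.3.2 (first display) p. 1097; (5.14) p. 1092] -/
theorem tau_le_smallX_of_srwI_le (hd : 3 ≤ d) (p : unitInterval) (hp : p < criticalProbI d) {Γ₁ Γ₂ V : ℝ}
    (hΓ1 : (2 * d - 1) * (p : ℝ) ≤ Γ₁) (hΓ2 : nobleF2 d p ≤ Γ₂) (hV : srwI d 1 4 0 ≤ V) {x : Site d} (hx : ∑ j, |x j| = 2) :
    tau d p 0 x ≤ 2 * (Γ₁ / (2 * d - 1)) ^ 2 + (2 * d / (2 * d - 1) * Γ₁) ^ 4 * ((2 * d - 2) / (2 * d - 1) * Γ₂) * V := by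
  have hd2 : 2 ≤ d := by omega
  have hΓ2' : 0 ≤ (2 * d - 2) / (2 * d - 1) * Γ₂ := (nobleSup2_nonneg' p).trans (nobleSup2_le_of_nobleF2_le hd2 p hΓ2)
  refine (tau_le_of_sum_abs_eq_two hd p hp hΓ1 hΓ2 hx).trans ?_
  exact add_le_add le_rfl (mul_le_mul_of_nonneg_left hV (mul_nonneg (Even.pow_nonneg (by decide) _) hΓ2'))

/-! ## 3. Geometry of the shell and the pointwise majorant at the true tables -/

/-- `‖x‖₂² ≤ 4` on the shell `‖x‖₁ = 2` (`Σ x_j² ≤ 2 Σ |x_j|` as `|x_j| ≤ 2`) — the weight `‖x‖₂²` of (2.21) at the two shell orbits `2e₁`, `e₁ + e₂`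
(the notebook's factors `4` and `2`). [cite: FitznerVanDerHofstad2017, (2.21); notebook Percolation.nb `boundF3[2,o]`] -/
theorem euclidNorm_sq_le_four_of_sum_abs_eq_two {x : Site d} (hx : ∑ j, |x j| = 2) : euclidNorm x ^ 2 ≤ 4 := by
  have hsq : euclidNorm x ^ 2 = ∑ j, ((x j : ℤ) : ℝ) ^ 2 := by
    unfold euclidNorm; rw [Real.sq_sqrt (Finset.sum_nonneg fun i _ => sq_nonneg _)]
  have hle : ∀ j, x j ^ 2 ≤ 2 * |x j| := fun j => by
    have hj : |x j| ≤ 2 := by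
      have h := Finset.single_le_sum (fun i _ => abs_nonneg (x i)) (Finset.mem_univ j)
      rw [hx] at h; exact h
    nlinarith [abs_nonneg (x j), sq_abs (x j)]
  have hZ : ∑ j, x j ^ 2 ≤ 4 :=
    calc ∑ j, x j ^ 2 ≤ ∑ j, 2 * |x j| := Finset.sum_le_sum fun j _ => hle j
      _ = 2 * ∑ j, |x j| := by rw [Finset.mul_sum]
      _ = 4 := by rw [hx]; norm_num
  rw [hsq]; exact_mod_cast hZ

open F3Bounds in
/-- **The pointwise majorant at the TRUE tables**: for `d ≥ 9`, `p < p_c`, an admissible witness at well-formed `r` with (H-Γ) at `n ≤ 1` and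
`1 ≤ α̲_F`, `ℋ^{n,l}_p(x) ≤ boundHD75 (srwTrue d α̲_F ᾱ_F) n l x r` for `n ≤ 1` and all `l`, `x` — [NoBLE17] (3.87) pointwise, every table-side
condition (`K`, `U`, (H-T), (H-IM), (H-SC), (H-LOW), (H-IM1), (H-low1)) discharged by `NobleF3TrueTables` §2.
[cite: FitznerVanDerHofstad2016NoBLE, §3.3.5 (3.58)–(3.59) p. 1074 and (3.60)–(3.87) pp. 1075–1079] [cite: FitznerVanDerHofstad2017, §2.5; notebook General.nb `BoundHn`] -/
theorem nobleH_le_boundHD75_srwTrue (hd : 9 ≤ d) {p : unitInterval} (hp : (p : ℝ) < criticalProb (zdGraph d) (0 : Site d))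
    {B : NobleBeta} {E : NobleBetaF3} {r : F3Bounds.Args}
    (hW : ∃ (cΦ αΦ cF αF : ℝ) (RΦ RF : Site d → ℝ), NobleF3Witness d p B E r cΦ αΦ cF αF RΦ RF)
    (hr : r.WF) (hΓ : ∀ n ≤ 1, r.Gamma2dash ^ n * r.bRp ≤ r.bRpDelta) (hα1 : 1 ≤ r.afmin)
    {n : ℕ} (hn : n ≤ 1) (l : ℕ) (x : Site d) :
    nobleH d n l p x ≤ boundHD75 (srwTrue d r.afmin r.afmax) n l x r :=
  have hd1 : 1 ≤ d := by omega
  have hα : 0 < r.afmin := lt_of_lt_of_le one_pos hα1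
  (le_abs_self _).trans
    (abs_nobleH_le_boundHD75_of_witness (n := n) (by omega) hp hW hr (hΓ n hn) (srwTrue d r.afmin r.afmax)
      (fun _ _ _ => rfl) (fun _ _ _ => rfl) (fun m j y => srwTS_le_srwTrue_T m j y) l x
      (NobleF3Witness.step1_of_tables hd hα1 (srwTrue d r.afmin r.afmax)
        (fun m j y _ => srwJ_le_srwTrue_IM m j y) (fun m j y _ => srwI_le_mul_srwTrue_IM hd1 hα m j y)
        (fun m j y _ => mul_srwIShift2_le_mul_srwTrue_IM hd1 m j y) (fun j y => srwI_add_le_srwTrue_IM_negOne j y)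
        (fun j y => srwI_two_le_mul_srwTrue_IM_negOne hd1 hα j y) (fun m j y => srwTS_le_srwTrue_T m j y) n hn l x))

/-! ## 4. The six cells with the near/far reading of `(0,0,𝒳)` and `(1,0,𝒳)` -/

open F3Bounds in
/-- **(S2b)-IMPR at the true tables, near/far reading of the first two cells.**  For `d ≥ 9`, `p < p_c`, an admissible witness at well-formed `r`
with (H-Γ) at `n ≤ 1`, `1 ≤ α̲_F`, `b_k ≥ 0`: if on the shell `‖x‖₁ = 2` we have `4 τ_p(x) ≤ b₀` and `4 τ_p(x) + 2dp · b₂ ≤ b₁`, on `Q = {‖x‖₁ ≥ 3}` the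
table-majorant cells `boundHD75 (srwTrue …) 0 0 x r ≤ b₀`, `boundHD75 (srwTrue …) 1 0 x r ≤ b₁`, and the cells `(1,1)`, `(1,2)`, `(1,3)` on `𝒳`,
`(1,6)` at `0` as in `nobleWeightedDiagramBoundAt_of_witness_srwTrue`, then `NobleWeightedDiagramBoundAt d p b` ([FvdH17] (2.23): all six
`sup_{x ∈ S_k} ℋ^{n_k,l_k}_p(x) ≤ b_k`).  Shell: `ℋ^{0,0} = ‖x‖₂² τ ≤ 4τ`, `ℋ^{1,0} ≤ ‖x‖₂² τ + 2dp ℋ^{1,1} ≤ 4τ + 2dp b₂` (§1, cell `(1,1)`).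
[cite: FitznerVanDerHofstad2017, (2.21)–(2.23), §2.5; notebook Percolation.nb `boundF3[2,o]`, `boundF3[3,o]`]
[cite: FitznerVanDerHofstad2016NoBLE, §3.3.5 (3.87) p. 1079; §5.1 p. 1093 (the set Q)] -/
theorem nobleWeightedDiagramBoundAt_of_witness_srwTrue_smallX (hd : 9 ≤ d) {p : unitInterval}
    (hp : (p : ℝ) < criticalProb (zdGraph d) (0 : Site d)) {B : NobleBeta} {E : NobleBetaF3} {r : F3Bounds.Args}
    (hW : ∃ (cΦ αΦ cF αF : ℝ) (RΦ RF : Site d → ℝ), NobleF3Witness d p B E r cΦ αΦ cF αF RΦ RF)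
    (hr : r.WF) (hΓ : ∀ n ≤ 1, r.Gamma2dash ^ n * r.bRp ≤ r.bRpDelta) (hα1 : 1 ≤ r.afmin)
    {b : Fin 6 → ℝ} (hb : ∀ k, 0 ≤ b k)
    (hS0 : ∀ x : Site d, ∑ j, |x j| = 2 → 4 * tau d p 0 x ≤ b 0)
    (hS1 : ∀ x : Site d, ∑ j, |x j| = 2 → 4 * tau d p 0 x + 2 * d * (p : ℝ) * b 2 ≤ b 1)
    (h0Q : ∀ x : Site d, 3 ≤ ∑ j, |x j| → boundHD75 (srwTrue d r.afmin r.afmax) 0 0 x r ≤ b 0)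
    (h1Q : ∀ x : Site d, 3 ≤ ∑ j, |x j| → boundHD75 (srwTrue d r.afmin r.afmax) 1 0 x r ≤ b 1)
    (h2 : ∀ x ∈ calX d, boundHD75 (srwTrue d r.afmin r.afmax) 1 1 x r ≤ b 2)
    (h3 : ∀ x ∈ calX d, boundHD75 (srwTrue d r.afmin r.afmax) 1 2 x r ≤ b 3)
    (h4 : ∀ x ∈ calX d, boundHD75 (srwTrue d r.afmin r.afmax) 1 3 x r ≤ b 4)
    (h5 : boundHD75 (srwTrue d r.afmin r.afmax) 1 6 0 r ≤ b 5) :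
    NobleWeightedDiagramBoundAt d p b := by
  have hd2 : 2 ≤ d := by omega
  have h2dp : 0 ≤ 2 * d * (p : ℝ) := by have := p.2.1; positivity
  have hle : ∀ {n : ℕ}, n ≤ 1 → ∀ (l : ℕ) (x : Site d), nobleH d n l p x ≤ boundHD75 (srwTrue d r.afmin r.afmax) n l x r :=
    fun {n} hn l x => nobleH_le_boundHD75_srwTrue hd hp hW hr hΓ hα1 hn l x
  have hz : (0 : ℕ) ≤ 1 := Nat.zero_le 1
  have h4τ : ∀ x : Site d, ∑ j, |x j| = 2 → euclidNorm x ^ 2 * tau d p 0 x ≤ 4 * tau d p 0 x := fun x hx =>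
    mul_le_mul_of_nonneg_right (euclidNorm_sq_le_four_of_sum_abs_eq_two hx) (tau_nonneg p 0 x)
  refine nobleWeightedDiagramBoundAt_of_forall hb fun k => ?_
  fin_cases k
  · show ∀ x ∈ calX d, nobleH d 0 0 p x ≤ b 0
    refine forall_mem_calX_iff_shell_and_Q.2 ⟨fun x hx => ?_, fun x hx => (hle hz 0 x).trans (h0Q x hx)⟩
    rw [nobleH_zero_zero_eq]
    exact (h4τ x hx).trans (hS0 x hx)
  · show ∀ x ∈ calX d, nobleH d 1 0 p x ≤ b 1
    refine forall_mem_calX_iff_shell_and_Q.2 ⟨fun x hx => ?_, fun x hx => (hle le_rfl 0 x).trans (h1Q x hx)⟩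
    have h11x : nobleH d 1 1 p x ≤ b 2 := (hle le_rfl 1 x).trans (h2 x (mem_calX_of_two_le_sum_abs x hx.ge))
    calc nobleH d 1 0 p x ≤ euclidNorm x ^ 2 * tau d p 0 x + 2 * d * (p : ℝ) * nobleH d 1 1 p x := nobleH_one_zero_le hd2 p hp x
      _ ≤ 4 * tau d p 0 x + 2 * d * (p : ℝ) * b 2 := add_le_add (h4τ x hx) (mul_le_mul_of_nonneg_left h11x h2dp)
      _ ≤ b 1 := hS1 x hx
  · show ∀ x ∈ calX d, nobleH d 1 1 p x ≤ b 2
    exact fun x hx => (hle le_rfl 1 x).trans (h2 x hx)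
  · show ∀ x ∈ calX d, nobleH d 1 2 p x ≤ b 3
    exact fun x hx => (hle le_rfl 2 x).trans (h3 x hx)
  · show ∀ x ∈ calX d, nobleH d 1 3 p x ≤ b 4
    exact fun x hx => (hle le_rfl 3 x).trans (h4 x hx)
  · show ∀ x ∈ ({0} : Set (Site d)), nobleH d 1 6 p x ≤ b 5
    intro x hx
    rw [Set.mem_singleton_iff] at hx
    subst hx
    exact (hle le_rfl 6 0).trans h5

open F3Bounds in
/-- **The same from the extended simplified form** `NobleSimplifiedFormF3At d p B E` below `p_c` under `f₂(p) ≤ Γ₂`, at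
`r = NobleBetaF3.toArgs d B E Γ₂` (`1 ≤ α̲_F = B.αFlow`, `β_Δ < α̲_F`), near/far reading of the first two cells.
[cite: FitznerVanDerHofstad2017, (2.21)–(2.23), §2.5; notebook Percolation.nb `boundF3[2,o]`, `boundF3[3,o]`]
[cite: FitznerVanDerHofstad2016NoBLE, §3.3.5 (3.87) p. 1079; §3.3.4 pp. 1072–1074] -/
theorem nobleWeightedDiagramBoundAt_of_simplifiedFormF3_srwTrue_smallX (hd : 9 ≤ d) {p : unitInterval}
    (hp : (p : ℝ) < criticalProb (zdGraph d) (0 : Site d)) {B : NobleBeta} {E : NobleBetaF3} {Γ₂ : ℝ}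
    (hF3 : NobleSimplifiedFormF3At d p B E) (hΓ2 : nobleF2 d p ≤ Γ₂) (hα1 : 1 ≤ B.αFlow) (hgap : B.βΔ < B.αFlow)
    (hr : (NobleBetaF3.toArgs d B E Γ₂).WF)
    (hΓ : ∀ n ≤ 1, (NobleBetaF3.toArgs d B E Γ₂).Gamma2dash ^ n * (NobleBetaF3.toArgs d B E Γ₂).bRp ≤
      (NobleBetaF3.toArgs d B E Γ₂).bRpDelta)
    {b : Fin 6 → ℝ} (hb : ∀ k, 0 ≤ b k)
    (hS0 : ∀ x : Site d, ∑ j, |x j| = 2 → 4 * tau d p 0 x ≤ b 0)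
    (hS1 : ∀ x : Site d, ∑ j, |x j| = 2 → 4 * tau d p 0 x + 2 * d * (p : ℝ) * b 2 ≤ b 1)
    (h0Q : ∀ x : Site d, 3 ≤ ∑ j, |x j| → boundHD75 (srwTrue d B.αFlow E.αFup) 0 0 x (NobleBetaF3.toArgs d B E Γ₂) ≤ b 0)
    (h1Q : ∀ x : Site d, 3 ≤ ∑ j, |x j| → boundHD75 (srwTrue d B.αFlow E.αFup) 1 0 x (NobleBetaF3.toArgs d B E Γ₂) ≤ b 1)
    (h2 : ∀ x ∈ calX d, boundHD75 (srwTrue d B.αFlow E.αFup) 1 1 x (NobleBetaF3.toArgs d B E Γ₂) ≤ b 2)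
    (h3 : ∀ x ∈ calX d, boundHD75 (srwTrue d B.αFlow E.αFup) 1 2 x (NobleBetaF3.toArgs d B E Γ₂) ≤ b 3)
    (h4 : ∀ x ∈ calX d, boundHD75 (srwTrue d B.αFlow E.αFup) 1 3 x (NobleBetaF3.toArgs d B E Γ₂) ≤ b 4)
    (h5 : boundHD75 (srwTrue d B.αFlow E.αFup) 1 6 0 (NobleBetaF3.toArgs d B E Γ₂) ≤ b 5) :
    NobleWeightedDiagramBoundAt d p b :=
  nobleWeightedDiagramBoundAt_of_witness_srwTrue_smallX hd hp
    (hF3.exists_witness (by omega) hp hΓ2 (lt_of_lt_of_le one_pos hα1) hgap) hr hΓ hα1 hb hS0 hS1 h0Q h1Q h2 h3 h4 h5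

/-! ## 5. Packaging over the window as `NobleImprovementInputsAt`, shell cells in the bootstrap constants -/

open F3Bounds in
/-- **The improvement-step input of the numeric certificate at the true tables, near/far reading of the first two `f₃` cells.**  For `d ≥ 9`:
if at every `p ∈ (p_I, p_c)` with `f_i(p) ≤ Γ_i` the two-point function has the extended simplified form `NobleSimplifiedFormF3At d p B E`,
`1 ≤ α̲_F`, `β_Δ < α̲_F`, `r = NobleBetaF3.toArgs d B E (Γ 1)` is well formed with (H-Γ) at `n ≤ 1`, `I_{1,4}(0) ≤ V`, `b_k ≥ 0`, the two SHELL
inequalities `4 S ≤ b₀` and `4 S + (2d/(2d−1)) (Γ 0) · b₂ ≤ b₁` hold (`S = 2 (Γ₀/(2d−1))² + (2dΓ₀/(2d−1))⁴ ((2d−2)/(2d−1) Γ₁') V` with `Γ₀ = Γ 0`,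
`Γ₁' = Γ 1` the printed `Γ₁`, `Γ₂`), the table-majorant cells
`(0,0)`, `(1,0)` hold on `Q = {‖x‖₁ ≥ 3}` and the cells `(1,1)`, `(1,2)`, `(1,3)` on `𝒳`, `(1,6)` at `0`, at `srwTrue d B.αFlow E.αFup`, then
`NobleImprovementInputsAt d cμ c Γ B b`.  On the window `(2d−1)p ≤ f₁(p) ≤ Γ₁ = Γ 0` and `f₂(p) ≤ Γ₂ = Γ 1`, so `τ_p ≤ S` on the shell (§2)
and `2dp ≤ (2d/(2d−1)) Γ₁`.
[cite: FitznerVanDerHofstad2017, Prop. 2.1–2.2, (2.19), (2.21)–(2.23), §2.5; §4.2 (4.18); notebook Percolation.nb `boundF3[2,o]`, `boundF3[3,o]`]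
[cite: FitznerVanDerHofstad2016NoBLE, §3.3.5 (3.87) p. 1079; Assumption 2.7 and Prop. 4.5 (pp. 1059–1060, 1088); §5.3.2 p. 1097] -/
theorem nobleImprovementInputsAt_of_simplifiedFormF3_srwTrue_smallX (hd : 9 ≤ d) {cμ : ℝ} {c : Fin 6 → ℝ} {Γ : Fin 3 → ℝ}
    {B : NobleBeta} {E : NobleBetaF3}
    (hF3 : ∀ p : unitInterval, p ∈ Set.Ioo (nbwThresholdI d) (criticalProbI d) →
      (∀ i, Literature.Barriers.CriticalPhenomena.nobleF d cμ c i p ≤ Γ i) → NobleSimplifiedFormF3At d p B E)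
    (hα1 : 1 ≤ B.αFlow) (hgap : B.βΔ < B.αFlow) (hr : (NobleBetaF3.toArgs d B E (Γ 1)).WF)
    (hΓ : ∀ n ≤ 1, (NobleBetaF3.toArgs d B E (Γ 1)).Gamma2dash ^ n * (NobleBetaF3.toArgs d B E (Γ 1)).bRp ≤
      (NobleBetaF3.toArgs d B E (Γ 1)).bRpDelta)
    {V : ℝ} (hV : srwI d 1 4 0 ≤ V) {b : Fin 6 → ℝ} (hb : ∀ k, 0 ≤ b k)
    (hS0 : 4 * (2 * (Γ 0 / (2 * d - 1)) ^ 2 + (2 * d / (2 * d - 1) * Γ 0) ^ 4 * ((2 * d - 2) / (2 * d - 1) * Γ 1) * V) ≤ b 0)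
    (hS1 : 4 * (2 * (Γ 0 / (2 * d - 1)) ^ 2 + (2 * d / (2 * d - 1) * Γ 0) ^ 4 * ((2 * d - 2) / (2 * d - 1) * Γ 1) * V) +
      2 * d / (2 * d - 1) * Γ 0 * b 2 ≤ b 1)
    (h0Q : ∀ x : Site d, 3 ≤ ∑ j, |x j| → boundHD75 (srwTrue d B.αFlow E.αFup) 0 0 x (NobleBetaF3.toArgs d B E (Γ 1)) ≤ b 0)
    (h1Q : ∀ x : Site d, 3 ≤ ∑ j, |x j| → boundHD75 (srwTrue d B.αFlow E.αFup) 1 0 x (NobleBetaF3.toArgs d B E (Γ 1)) ≤ b 1)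
    (h2 : ∀ x ∈ calX d, boundHD75 (srwTrue d B.αFlow E.αFup) 1 1 x (NobleBetaF3.toArgs d B E (Γ 1)) ≤ b 2)
    (h3 : ∀ x ∈ calX d, boundHD75 (srwTrue d B.αFlow E.αFup) 1 2 x (NobleBetaF3.toArgs d B E (Γ 1)) ≤ b 3)
    (h4 : ∀ x ∈ calX d, boundHD75 (srwTrue d B.αFlow E.αFup) 1 3 x (NobleBetaF3.toArgs d B E (Γ 1)) ≤ b 4)
    (h5 : boundHD75 (srwTrue d B.αFlow E.αFup) 1 6 0 (NobleBetaF3.toArgs d B E (Γ 1)) ≤ b 5) :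
    NobleImprovementInputsAt d cμ c Γ B b := by
  intro p hp hf
  have hF := hF3 p hp hf
  have hpc : (p : ℝ) < criticalProb (zdGraph d) (0 : Site d) := by
    rw [← coe_criticalProbI]
    exact Subtype.coe_lt_coe.2 hp.2
  have hΓ1 : (2 * d - 1) * (p : ℝ) ≤ Γ 0 := (two_d_sub_one_mul_le_nobleF1 cμ p).trans (by simpa only [nobleF_zero] using hf 0)
  have hΓ2 : nobleF2 d p ≤ Γ 1 := by simpa only [nobleF_one] using hf 1
  have hτ : ∀ x : Site d, ∑ j, |x j| = 2 →
      tau d p 0 x ≤ 2 * (Γ 0 / (2 * d - 1)) ^ 2 + (2 * d / (2 * d - 1) * Γ 0) ^ 4 * ((2 * d - 2) / (2 * d - 1) * Γ 1) * V :=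
    fun x hx => tau_le_smallX_of_srwI_le (by omega) p hp.2 hΓ1 hΓ2 hV hx
  have h2dp : 2 * d * (p : ℝ) * b 2 ≤ 2 * d / (2 * d - 1) * Γ 0 * b 2 :=
    mul_le_mul_of_nonneg_right (two_d_mul_le_of_le (by omega) p hΓ1) (hb 2)
  exact ⟨hF.toSimplifiedFormAt, nobleWeightedDiagramBoundAt_of_simplifiedFormF3_srwTrue_smallX hd hpc hF hΓ2 hα1 hgap hr hΓ hb
    (fun x hx => by linarith [hτ x hx]) (fun x hx => by linarith [hτ x hx]) h0Q h1Q h2 h3 h4 h5⟩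

end Literature.Probability.FitznerVanDerHofstad2017

end
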